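import Summits.NavierStokesRegularity.NavierStokesRegularity.Theorems.ThreadingFluxCentreVirialFluxProfile
import HarnessLib

/-!
# Crux `PoloidalLiouville` (stmt-NavierStokesRegularity-1222, W1), crux idea «centre-virial» (ns-idea-15 g9):
# (V1′) the weighted centre-virial identity and (V0) vanishing radial moments, by name

* `weightedVirialIdentity : WeightedVirialIdentity` (V1′): off the centre, `div(r⁻³F) = r⁻⁵(r²|u|² − 3m²)` for the flux field
  `F = p y + m u + ω × y` of a classical steady flow — Leibniz rule with `∇(r⁻³) = −3r⁻⁵ y` (the weight differentiated through
  the squared radius, `r⁻³ = (σ√σ)⁻¹`, `σ = |y|²`), V1 `centreVirialIdentity` and `⟪F, y⟫ = p r² + m²`.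
* `radialMomentVanishes : RadialMomentVanishes` (V0): `∫_{B_t(x₀)} φ(|y|)⟪y, w⟫ = 0` for `w ∈ C¹` divergence-free and `φ`
  continuous — the ball/shell Gauss–Green identity `ball_shell_flux` with `a = 0`, `b = t`, density `φ ∘ √`, `div w = 0`, plus
  the null sets `{x₀}`, `S_t`.  (On the card this is what makes the integrated virial identities hold slice-wise for UNSTEADY
  incompressible flows.)

With these two, every routine (S) statement of the centre-virial card is a tree theorem by name (V0, V1, V1′), as are F1, F2,
B and T1; open remain H (Hodge slaving, L), T2 (⇐ H), and the conjectures T0 / Galdi.  Information-grade; W1 movement 0;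
NS regularity is NOT proved.  `--supports stmt-NavierStokesRegularity-1222 --as helper`.  Filed by ns-wall-eng-4 g6.
[cite: KorobkovPileckasRusso2015, Thm 3.6]
-/

-- the summit and its single sub-problem share the name (CONVENTIONS §1)
set_option linter.dupNamespace false

noncomputable section

namespace Summit.NavierStokesRegularity.NavierStokesRegularity.Theorems.PoloidalLiouville.CentreVirial

open Set Function MeasureTheory Filter Topology
open Literature.Analysis.FluidPDE
open Literature.Analysis.FluidPDE.VectorCalculus (divergence IsDivFree)
open Summit.NavierStokesRegularity.NavierStokesRegularity.Theorems.PoloidalLiouville.CentreJet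
  (E3 IsUnthreadedAbout IsSteadyNSOn)
open scoped RealInnerProductSpace

/-- **(V1′) `WeightedVirialIdentity` — the weighted centre-virial identity holds**: off the centre,
`div(r⁻³ F) = r⁻⁵(r²|u|² − 3m²)` for the flux field `F = p y + m u + ω × y` of a classical steady flow
(`div(r⁻³F) = r⁻³ div F + ⟪F, ∇r⁻³⟫ = r⁻³(3p + |u|²) − 3r⁻⁵(p r² + m²)` by V1 and `⟪F, y⟫ = p r² + m²`). [idea-15 g9 card, (V1′)]
[cite: KorobkovPileckasRusso2015, Thm 3.6] -/
theorem weightedVirialIdentity : WeightedVirialIdentity := by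
  intro u p x₀ h x hx
  have hV1 := centreVirialIdentity u p x₀ h x
  have hu3 : ContDiff ℝ 3 u := contDiffOn_univ.mp h.1
  have hp1 : ContDiff ℝ 1 p := contDiffOn_univ.mp h.2.1
  have hF : ContDiff ℝ 1 (virialField x₀ u p) := contDiff_virialField x₀ hu3 hp1
  have hFd : DifferentiableAt ℝ (virialField x₀ u p) x := hF.differentiable one_ne_zero x
  have hr : 0 < ‖x - x₀‖ := norm_pos_iff.2 (sub_ne_zero.2 hx)
  set σ : ℝ := ‖x - x₀‖ ^ 2 with hσ_def
  have hσ : 0 < σ := by positivity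
  have hsq : Real.sqrt σ = ‖x - x₀‖ := by rw [hσ_def, Real.sqrt_sq hr.le]
  -- the weight as a function of the squared radius
  have hw_eq : (fun y : E3 => (‖y - x₀‖ ^ 3)⁻¹) =
      (fun s : ℝ => -(-(s * Real.sqrt s)⁻¹)) ∘ fun y : E3 => ‖y - x₀‖ ^ 2 := by
    funext y
    simp only [Function.comp_apply, neg_neg, Real.sqrt_sq (norm_nonneg _)]
    ring
  have h1 : HasFDerivAt (fun y : E3 => y - x₀) (ContinuousLinearMap.id ℝ E3) x := (hasFDerivAt_id x).sub_const x₀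
  have h2 := h1.norm_sq
  have h3 : HasDerivAt (fun s : ℝ => -(-(s * Real.sqrt s)⁻¹)) (-(3 / (2 * σ ^ 2 * Real.sqrt σ))) σ :=
    (hasDerivAt_neg_inv_mul_sqrt hσ).neg
  have h4 := h3.comp_hasFDerivAt x h2
  rw [← hw_eq] at h4
  have hwd : DifferentiableAt ℝ (fun y : E3 => (‖y - x₀‖ ^ 3)⁻¹) x := h4.differentiableAt
  rw [divergence_smul_apply hwd hFd, hV1, ← real_inner_comm, gradient, InnerProductSpace.toDual_symm_apply, h4.fderiv]
  simp only [_root_.FunLike.coe_smul, Pi.smul_apply, ContinuousLinearMap.comp_apply, ContinuousLinearMap.id_apply,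
    innerSL_apply_apply, smul_eq_mul]
  rw [real_inner_comm, inner_virialField_self, hsq, hσ_def]
  have hr0 : ‖x - x₀‖ ≠ 0 := hr.ne'
  field_simp
  ring

/-- **(V0) `RadialMomentVanishes` — radial moments of divergence-free fields vanish on balls**:
`∫_{B_t(x₀)} φ(|y|)⟪y, w⟫ = 0` for `w ∈ C¹` divergence-free, `φ` continuous, `t > 0`.  One line from the ball/shell
Gauss–Green identity `ball_shell_flux` with `a = 0`, `b = t`, density `ζ = φ ∘ √` and `div w = 0` (both left-hand terms
vanish), plus the null sets `{x₀}` and `S_t`.  Consequence recorded on the card: the integrated centre-virial identities hold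
slice-wise for UNSTEADY incompressible flows. [idea-15 g9 card, (V0)] [cite: KorobkovPileckasRusso2015, Thm 3.6] -/
theorem radialMomentVanishes : RadialMomentVanishes := by
  intro x₀ w φ t hw hdiv hφ ht
  have key := ball_shell_flux hw x₀ (ζ := fun s => φ (Real.sqrt s)) (hφ.comp Real.continuous_sqrt) le_rfl ht
  have hdiv0 : ∀ x, divergence w x = 0 := hdiv
  simp only [hdiv0, mul_zero, integral_zero] at key
  -- `key : 0 + 0 = 2 * ∫_{0 < |y| ≤ t} φ(√(|y|²)) ⟪w, y⟫`
  set T : Set E3 := {x | 0 < ‖x - x₀‖ ∧ ‖x - x₀‖ ≤ t} with hT_def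
  have hae : (T : Set E3) =ᵐ[volume] Metric.ball x₀ t := by
    refine (ae_eq_set).2 ⟨?_, ?_⟩
    · refine measure_mono_null (fun x hx => ?_) (Measure.addHaar_sphere volume x₀ t)
      simp only [Set.mem_sdiff, hT_def, Set.mem_setOf_eq, Metric.mem_ball, dist_eq_norm, not_lt] at hx
      rw [Metric.mem_sphere, dist_eq_norm]
      exact le_antisymm hx.1.2 hx.2
    · refine measure_mono_null (fun x hx => ?_) (measure_singleton x₀)
      simp only [Set.mem_sdiff, hT_def, Set.mem_setOf_eq, Metric.mem_ball, dist_eq_norm, not_and, not_le] at hx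
      rw [Set.mem_singleton_iff]
      by_contra hne
      have hpos : 0 < ‖x - x₀‖ := norm_pos_iff.2 (sub_ne_zero.2 hne)
      linarith [hx.2 hpos, hx.1]
  have hint : ∫ x in T, φ (Real.sqrt (‖x - x₀‖ ^ 2)) * ⟪w x, x - x₀⟫ =
      ∫ x in Metric.ball x₀ t, φ ‖x - x₀‖ * inner ℝ (x - x₀) (w x) := by
    rw [setIntegral_congr_set hae]
    refine integral_congr_ae (Eventually.of_forall fun x => ?_)
    show φ (Real.sqrt (‖x - x₀‖ ^ 2)) * ⟪w x, x - x₀⟫ = φ ‖x - x₀‖ * ⟪x - x₀, w x⟫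
    rw [Real.sqrt_sq (norm_nonneg _), real_inner_comm]
  rw [hint] at key
  linarith

end Summit.NavierStokesRegularity.NavierStokesRegularity.Theorems.PoloidalLiouville.CentreVirial
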